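import Mathlib.Analysis.Complex.Hadamard
import Mathlib.Analysis.SpecialFunctions.Trigonometric.DerivHyp
import Mathlib.Analysis.Complex.ExponentialBounds
import Mathlib.Analysis.SpecialFunctions.Pow.Real
import HarnessLib

/-!
# RSW3 lane (lead, gen 25): QUANTITATIVE HARRIS WITH LOGARITHMIC LOSS, I — the De–Nadimpalli–Servedio extremal lemma:
# a power series `p(t) = Σ_{i≥1} c_i t^i` with `c_1 = 1` and length `Σ|c_i| ≤ M` satisfies `sup_{[0,1]} |p| ≥ 1/(40·log² M)`

builds on p205010 (kernel theorem, internal audit signed; external expert review pending) — NOT used in this file (pure analysis).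

Cell `prim-rsw3` (LANE 3), lead seat, gen 25.  Support file (`--supports stmt-CriticalPhenomena-4575`); no definitions, no named facts,
no sorries.  This is the analytic engine of the generation: De, Nadimpalli and Servedio (ITCS 2021) turn a QUALITATIVE correlation inequality
(for us: Harris–FKG on the biased cube, in the semigroup form `ρ ↦ E[f·T_ρ g]` non-decreasing — gen 23's `noise_cross_correlation_antitone`)
into a QUANTITATIVE one with only logarithmic loss, with no hypercontractivity and no dependence on the bias, through the following
extremal property of power series of bounded length (their Lemma 13, proved there with Hadamard's three-circles theorem and inspired by
Borwein–Erdélyi).  Here it is proved with Mathlib's Hadamard three-LINES theorem applied to the ENTIRE function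
`F(w) = Σ_{i<D} c_{i+1}·(2A·cosh w + B)^i` on the strip `0 ≤ Re w ≤ 2` (the exponential of the strip is the annulus `1 ≤ |z| ≤ e²`; the
Joukowski-type map `z ↦ A(z + 1/z) + B` of DNS becomes `w ↦ 2A cosh w + B`): with `A = 1/(2cosh 2 + 2cosh u)`, `B = 2A cosh u`,

* on `Re w = 0` the argument `2A cos(Im w) + B` is REAL and lies in `[δ, 1)`, `δ = B − 2A = 2A(cosh u − 1) > 0`, where `|q| ≤ η/δ` if
  `|p| ≤ η` on `[0,1]` (`q(τ) = p(τ)/τ = Σ c_{i+1} τ^i`);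
* on the whole closed strip `|2A cosh w + B| ≤ 2A cosh 2 + B = 1`, so `|F| ≤ Σ|c_i| ≤ M`;
* at `w₀ = u + πi`, `cosh w₀ = −cosh u`, the argument vanishes and `F(w₀) = c_1 = 1`.

Three lines: `1 = |F(w₀)| ≤ (η/δ)^{1−u/2}·M^{u/2}`, i.e. **`η ≥ δ(u)·M^{−u/(2−u)}`** for every `0 < u < 2` (`le_of_forall_abs_eval_le`), and the
choice `u = 1/log M` (`log M ≥ 2`) gives **`η ≥ 1/(40·log² M)`** (`le_of_forall_abs_eval_le_log`; DNS have `Θ(1)/log² M` and show the exponent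
`2` of the logarithm is optimal).  For a power series that is NONNEGATIVE AND NON-DECREASING on `[0,1]` with `p(0) = 0` — the case of the
correlation function `ρ ↦ E[f·T_ρ g] − E f·E g` of a monotone pair — the supremum is `p(1)`: **`p(1) ≥ 1/(40·log² max(e², M))`**
(`eval_one_ge_of_monotone`).  Part II (`…HarrisSlackLogarithmic`) feeds it the mixed spectral formula of gen 23.

References: A. De, S. Nadimpalli, R. A. Servedio, *Quantitative correlation inequalities via semigroup interpolation*, ITCS 2021 (LIPIcs 185)
Art. 69 = arXiv:2012.12216, §3 Lemma 13 and §4 Thm 15 [cite: DeNadimpalliServedio2021, Lemma 13 / Thm 15]; P. Borwein, T. Erdélyi,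
*Littlewood-type problems on subarcs of the unit circle*, Indiana Univ. Math. J. 46 (1997) (three-circles arguments for polynomials with
bounded coefficients); M. Talagrand, *How much are increasing sets positively correlated?*, Combinatorica 16 (1996) 243–258 (the inequality
this recovers up to one logarithm); W. Rudin, *Real and Complex Analysis*, Thm 12.8 (Hadamard three-lines / three-circles).
-/

noncomputable section

namespace Summit.CriticalPhenomena.PercolationContinuityZ3.Theorems.Crossing.Extremal

open Complex Finset

/-! ## §1 Two facts about the complex hyperbolic cosine -/

/-- `cosh(w + πi) = −cosh w`. -/
theorem cosh_add_pi_mul_I (w : ℂ) : Complex.cosh (w + Real.pi * I) = -Complex.cosh w := by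
  have h1 : Complex.cosh (w + Real.pi * I) = (Complex.exp (w + Real.pi * I) + Complex.exp (-(w + Real.pi * I))) / 2 := rfl
  have h2 : Complex.cosh w = (Complex.exp w + Complex.exp (-w)) / 2 := rfl
  rw [h1, h2, Complex.exp_add_pi_mul_I, show -(w + Real.pi * I) = -w - Real.pi * I by ring, Complex.exp_sub_pi_mul_I]
  ring

/-- On the imaginary axis `cosh(yi) = cos y` is real. -/
theorem cosh_ofReal_mul_I (y : ℝ) : Complex.cosh ((y : ℂ) * I) = (Real.cos y : ℂ) := by
  rw [Complex.cosh_mul_I, Complex.ofReal_cos]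

/-! ## §2 The De–Nadimpalli–Servedio extremal lemma -/

/-- **THE DE–NADIMPALLI–SERVEDIO EXTREMAL LEMMA, parametric form.**  Let `p(t) = Σ_{i<D} c_{i+1} t^{i+1}` (`D ≥ 1`) be a real polynomial
with `c_1 = 1` and length `Σ_{i<D} |c_{i+1}| ≤ M`, and suppose `|p(t)| ≤ η` for all `t ∈ [0,1]`.  Then for every `0 < u < 2`,
**`(cosh u − 1)/(cosh 2 + cosh u) · M^{−u/(2−u)} ≤ η`**.  Proof: Hadamard's three-lines theorem for the entire function
`F(w) = Σ_{i<D} c_{i+1}(2A cosh w + B)^i`, `A = 1/(2cosh 2 + 2cosh u)`, `B = 2A cosh u`, on the strip `0 ≤ Re w ≤ 2`, evaluated at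
`w₀ = u + πi` where `F(w₀) = c_1 = 1`; the bounds on the two lines are `η/δ` (`δ = 2A(cosh u − 1)`) and `M`.
[cite: DeNadimpalliServedio2021, §3 Lemma 13 (via Hadamard's three-circles theorem)] -/
theorem le_of_forall_abs_eval_le (c : ℕ → ℝ) {D : ℕ} (hD : 1 ≤ D) (hc1 : c 1 = 1) {M : ℝ}
    (hM : ∑ i ∈ Finset.range D, |c (i + 1)| ≤ M) {η : ℝ}
    (hη : ∀ t : ℝ, 0 ≤ t → t ≤ 1 → |∑ i ∈ Finset.range D, c (i + 1) * t ^ (i + 1)| ≤ η)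
    {u : ℝ} (hu0 : 0 < u) (hu2 : u < 2) :
    (Real.cosh u - 1) / (Real.cosh 2 + Real.cosh u) * M ^ (-(u / (2 - u))) ≤ η := by
  -- the length dominates `|c_1| = 1`, so `M ≥ 1`
  have hM1 : 1 ≤ M := by
    have h0D : 0 ∈ Finset.range D := Finset.mem_range.2 (by omega)
    have := Finset.single_le_sum (f := fun i => |c (i + 1)|) (fun i _ => abs_nonneg _) h0D
    simp only [zero_add, hc1, abs_one] at this
    linarith
  have hMpos : 0 < M := by linarith
  -- `η ≥ 0` (take `t = 0`)
  have hη0 : 0 ≤ η := by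
    have := hη 0 le_rfl zero_le_one
    simp only [ne_eq, add_eq_zero, one_ne_zero, and_false, not_false_eq_true, zero_pow, mul_zero,
      Finset.sum_const_zero, abs_zero] at this
    exact this
  -- the constants
  have hcu : 1 < Real.cosh u := Real.one_lt_cosh.2 hu0.ne'
  have hc2 : 1 < Real.cosh 2 := Real.one_lt_cosh.2 (by norm_num)
  set A : ℝ := 1 / (2 * Real.cosh 2 + 2 * Real.cosh u) with hA
  have hApos : 0 < A := by rw [hA]; positivity
  set B : ℝ := 2 * A * Real.cosh u with hB
  set δ : ℝ := 2 * A * (Real.cosh u - 1) with hδ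
  have hδpos : 0 < δ := by rw [hδ]; nlinarith
  have hδBA : δ = B - 2 * A := by rw [hδ, hB]; ring
  have hsum1 : 2 * A * Real.cosh 2 + B = 1 := by
    rw [hB, hA]; field_simp
  have hBA1 : B + 2 * A < 1 := by nlinarith
  -- the entire function
  set τ : ℂ → ℂ := fun w => (2 * A : ℝ) * Complex.cosh w + (B : ℝ) with hτ
  set F : ℂ → ℂ := fun w => ∑ i ∈ Finset.range D, (c (i + 1) : ℂ) * τ w ^ i with hF
  -- `|cosh w| ≤ cosh(Re w)` (the tree has this as `Literature.Barriers.RiemannHypothesis.norm_ccosh_le_cosh_re`; re-derived inline rather than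
  -- importing an Epstein-zeta barrier file into a percolation file)
  have hnorm_cosh : ∀ w : ℂ, ‖Complex.cosh w‖ ≤ Real.cosh w.re := by
    intro w
    have h : Complex.cosh w = (Complex.exp w + Complex.exp (-w)) / 2 := rfl
    rw [h, norm_div, Real.cosh_eq]
    have h2 : ‖(2 : ℂ)‖ = 2 := by simp
    rw [h2]
    gcongr
    calc ‖Complex.exp w + Complex.exp (-w)‖ ≤ ‖Complex.exp w‖ + ‖Complex.exp (-w)‖ := norm_add_le _ _
      _ = Real.exp w.re + Real.exp (-w.re) := by rw [Complex.norm_exp, Complex.norm_exp, neg_re]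
  -- (F1) `|τ w| ≤ 1` on the closed strip
  have hτle : ∀ w : ℂ, 0 ≤ w.re → w.re ≤ 2 → ‖τ w‖ ≤ 1 := by
    intro w hw0 hw2
    have hcw : ‖Complex.cosh w‖ ≤ Real.cosh 2 :=
      (hnorm_cosh w).trans (Real.cosh_le_cosh.2 (by rw [abs_of_nonneg hw0, abs_of_pos (by norm_num : (0:ℝ) < 2)]; exact hw2))
    calc ‖τ w‖ ≤ ‖((2 * A : ℝ) : ℂ) * Complex.cosh w‖ + ‖((B : ℝ) : ℂ)‖ := norm_add_le _ _
      _ = 2 * A * ‖Complex.cosh w‖ + B := by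
          rw [norm_mul, Complex.norm_real, Complex.norm_real, Real.norm_of_nonneg (by positivity),
            Real.norm_of_nonneg (by rw [hB]; positivity)]
      _ ≤ 2 * A * Real.cosh 2 + B := by gcongr
      _ = 1 := hsum1
  -- (F2) `|F w| ≤ M` on the closed strip
  have hFle : ∀ w : ℂ, 0 ≤ w.re → w.re ≤ 2 → ‖F w‖ ≤ M := by
    intro w hw0 hw2
    calc ‖F w‖ ≤ ∑ i ∈ Finset.range D, ‖(c (i + 1) : ℂ) * τ w ^ i‖ := norm_sum_le _ _
      _ ≤ ∑ i ∈ Finset.range D, |c (i + 1)| := by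
          refine Finset.sum_le_sum fun i _ => ?_
          rw [norm_mul, Complex.norm_real, Real.norm_eq_abs, norm_pow]
          calc |c (i + 1)| * ‖τ w‖ ^ i ≤ |c (i + 1)| * 1 := by
                gcongr; exact pow_le_one₀ (norm_nonneg _) (hτle w hw0 hw2)
            _ = |c (i + 1)| := mul_one _
      _ ≤ M := hM
  -- (F3) on the imaginary axis `F` is `q` at a real point of `[δ, 1)`
  have hF0 : ∀ w : ℂ, w.re = 0 → ‖F w‖ ≤ η / δ := by
    intro w hw
    -- the real argument
    set t : ℝ := 2 * A * Real.cos w.im + B with ht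
    have hwI : w = (w.im : ℂ) * I := by
      apply Complex.ext <;> simp [hw]
    have hτt : τ w = (t : ℂ) := by
      simp only [hτ]
      rw [hwI, cosh_ofReal_mul_I, ht]; push_cast; ring
    have htδ : δ ≤ t := by
      rw [hδBA, ht]; nlinarith [Real.neg_one_le_cos w.im]
    have ht1 : t ≤ 1 := by
      rw [ht]; nlinarith [Real.cos_le_one w.im]
    have htpos : 0 < t := lt_of_lt_of_le hδpos htδ
    have hFt : F w = ((∑ i ∈ Finset.range D, c (i + 1) * t ^ i : ℝ) : ℂ) := by
      simp only [hF]
      rw [hτt]; push_cast; rfl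
    have hpt : (∑ i ∈ Finset.range D, c (i + 1) * t ^ (i + 1)) = t * ∑ i ∈ Finset.range D, c (i + 1) * t ^ i := by
      rw [Finset.mul_sum]; exact Finset.sum_congr rfl fun i _ => by ring
    have hq : |∑ i ∈ Finset.range D, c (i + 1) * t ^ i| ≤ η / t := by
      rw [le_div_iff₀ htpos]
      have := hη t htpos.le ht1
      rw [hpt, abs_mul, abs_of_pos htpos] at this
      linarith
    rw [hFt, Complex.norm_real, Real.norm_eq_abs]
    exact hq.trans (div_le_div_of_nonneg_left hη0 hδpos htδ)
  -- (F4) the value at `w₀ = u + πi`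
  set w₀ : ℂ := (u : ℂ) + Real.pi * I with hw₀
  have hw₀re : w₀.re = u := by simp [hw₀]
  have hτw₀ : τ w₀ = 0 := by
    simp only [hτ]
    rw [hw₀, cosh_add_pi_mul_I, ← Complex.ofReal_cosh]
    have : 2 * A * (-Real.cosh u) + B = 0 := by rw [hB]; ring
    have h' : -(((2 * A : ℝ) : ℂ) * ((Real.cosh u : ℝ) : ℂ)) + ((B : ℝ) : ℂ) = ((2 * A * (-Real.cosh u) + B : ℝ) : ℂ) := by
      push_cast; ring
    rw [mul_neg, h', this]; simp
  have hFw₀ : F w₀ = 1 := by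
    simp only [hF]
    rw [hτw₀]
    have hD' : Finset.range D = insert 0 ((Finset.range D).erase 0) := by
      rw [Finset.insert_erase (Finset.mem_range.2 (by omega))]
    rw [hD', Finset.sum_insert (Finset.notMem_erase 0 _)]
    rw [Finset.sum_eq_zero (fun i hi => by
      have hi0 : i ≠ 0 := Finset.ne_of_mem_erase hi
      rw [zero_pow hi0, mul_zero])]
    simp [hc1]
  -- Hadamard's three-lines theorem on the strip `0 ≤ Re w ≤ 2`
  have h3 := Complex.HadamardThreeLines.norm_le_interp_of_mem_verticalClosedStrip' (f := F) (z := w₀) (a := η / δ) (b := M)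
    (l := 0) (u := 2) (by norm_num)
    (by
      simp only [Complex.HadamardThreeLines.verticalClosedStrip, Set.mem_preimage, Set.mem_Icc, hw₀re]
      exact ⟨hu0.le, hu2.le⟩)
    (by
      apply Differentiable.diffContOnCl
      simp only [hF, hτ]
      fun_prop)
    (by
      refine ⟨M, ?_⟩
      rintro _ ⟨w, hw, rfl⟩
      simp only [Complex.HadamardThreeLines.verticalClosedStrip, Set.mem_preimage, Set.mem_Icc] at hw
      exact hFle w hw.1 hw.2)
    (by
      intro w hw
      simp only [Set.mem_preimage, Set.mem_singleton_iff] at hw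
      exact hF0 w hw)
    (by
      intro w hw
      simp only [Set.mem_preimage, Set.mem_singleton_iff] at hw
      exact hFle w (by rw [hw]; norm_num) (by rw [hw]))
  rw [hFw₀, norm_one, hw₀re, sub_zero, sub_zero] at h3
  -- unpack `1 ≤ (η/δ)^{1−u/2} · M^{u/2}`
  have hθ0 : 0 < 1 - u / 2 := by linarith
  have hθ1 : 0 < u / 2 := by linarith
  have ha0 : 0 ≤ η / δ := div_nonneg hη0 hδpos.le
  have hapos : 0 < η / δ := by
    rcases ha0.lt_or_eq with h | h
    · exact h
    · exfalso
      rw [← h, Real.zero_rpow hθ0.ne', zero_mul] at h3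
      linarith
  -- logarithms: `0 ≤ (1 − u/2)·log(η/δ) + (u/2)·log M`
  have hlog : 0 ≤ (1 - u / 2) * Real.log (η / δ) + (u / 2) * Real.log M := by
    have hpos : 0 < (η / δ) ^ (1 - u / 2) * M ^ (u / 2) := by positivity
    have := Real.log_le_log one_pos h3
    rw [Real.log_one, Real.log_mul (Real.rpow_pos_of_pos hapos _).ne' (Real.rpow_pos_of_pos hMpos _).ne',
      Real.log_rpow hapos, Real.log_rpow hMpos] at this
    exact this
  -- hence `log(η/δ) ≥ −(u/(2−u))·log M`, i.e. `η/δ ≥ M^{−u/(2−u)}`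
  have hlog' : -(u / (2 - u)) * Real.log M ≤ Real.log (η / δ) := by
    have h2u : 0 < 2 - u := by linarith
    have key : (2 - u) * Real.log (η / δ) + u * Real.log M ≥ 0 := by nlinarith
    rw [neg_mul, neg_le, div_mul_eq_mul_div, le_div_iff₀ h2u]
    nlinarith
  have hge : M ^ (-(u / (2 - u))) ≤ η / δ := by
    rw [Real.rpow_def_of_pos hMpos, ← Real.exp_log hapos]
    exact Real.exp_le_exp.2 (by rw [mul_comm]; exact hlog')
  -- conclude
  have hδeq : (Real.cosh u - 1) / (Real.cosh 2 + Real.cosh u) = δ := by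
    rw [hδ, hA]; field_simp
  rw [hδeq]
  calc δ * M ^ (-(u / (2 - u))) ≤ δ * (η / δ) := by gcongr
    _ = η := by field_simp

/-! ## §3 Numerical constants and the logarithmic form -/

/-- `cosh 2 ≤ 21/5` (crude: `e² ≤ 7.4`, `e^{−2} ≤ 1`). -/
theorem cosh_two_le : Real.cosh 2 ≤ 21 / 5 := by
  rw [Real.cosh_eq]
  have h1 : Real.exp 2 ≤ 74 / 10 := by
    have := Real.exp_one_lt_d9
    have h : Real.exp 2 = Real.exp 1 * Real.exp 1 := by rw [← Real.exp_add]; norm_num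
    rw [h]; nlinarith [Real.exp_pos 1]
  have h2 : Real.exp (-2) ≤ 1 := by
    rw [Real.exp_le_one_iff]; norm_num
  linarith

/-- `cosh u ≤ 2` for `0 ≤ u ≤ 1` (crude: `cosh 1 = (e + e^{−1})/2 ≤ (2.72 + 1)/2`). -/
theorem cosh_le_two {u : ℝ} (hu0 : 0 ≤ u) (hu1 : u ≤ 1) : Real.cosh u ≤ 2 := by
  have h : Real.cosh u ≤ Real.cosh 1 :=
    Real.cosh_le_cosh.2 (by rw [abs_of_nonneg hu0, abs_one]; exact hu1)
  refine h.trans ?_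
  rw [Real.cosh_eq]
  have h1 : Real.exp 1 ≤ 2.72 := by have := Real.exp_one_lt_d9; linarith
  have h2 : Real.exp (-1) ≤ 1 := by rw [Real.exp_le_one_iff]; norm_num
  linarith

/-- `cosh u − 1 ≥ u²/2` for `u ≥ 0` (`cosh u − 1 = 2 sinh²(u/2)` and `sinh x ≥ x` for `x ≥ 0`). -/
theorem sq_div_two_le_cosh_sub_one {u : ℝ} (hu : 0 ≤ u) : u ^ 2 / 2 ≤ Real.cosh u - 1 := by
  have h : Real.cosh u = Real.cosh (u / 2) ^ 2 + Real.sinh (u / 2) ^ 2 := by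
    rw [← Real.cosh_two_mul]; congr 1; ring
  have h2 : Real.cosh (u / 2) ^ 2 = Real.sinh (u / 2) ^ 2 + 1 := Real.cosh_sq (u / 2)
  have hs : u / 2 ≤ Real.sinh (u / 2) := Real.self_le_sinh_iff.2 (by linarith)
  have hs0 : 0 ≤ u / 2 := by linarith
  nlinarith [mul_le_mul hs hs hs0 ((hs0.trans hs))]

/-- **THE DE–NADIMPALLI–SERVEDIO EXTREMAL LEMMA, logarithmic form**: if `p(t) = Σ_{i<D} c_{i+1}t^{i+1}` has `c_1 = 1`, length
`Σ_{i<D}|c_{i+1}| ≤ M` with `log M ≥ 2`, and `|p(t)| ≤ η` on `[0,1]`, then **`1/(40·(log M)²) ≤ η`** (the parametric form at `u = 1/log M`: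
`δ(u) ≥ u²/(2(cosh 2 + cosh u)) ≥ u²/12.4` and `M^{−u/(2−u)} = e^{−1/(2−u)} ≥ e^{−2/3} ≥ 1/3`).
[cite: DeNadimpalliServedio2021, §3 Lemma 13 (`sup_{t∈[0,1]}|p(t)| ≥ Θ(1)/log² M`)] -/
theorem le_of_forall_abs_eval_le_log (c : ℕ → ℝ) {D : ℕ} (hD : 1 ≤ D) (hc1 : c 1 = 1) {M : ℝ}
    (hM : ∑ i ∈ Finset.range D, |c (i + 1)| ≤ M) (hM2 : 2 ≤ Real.log M) {η : ℝ}
    (hη : ∀ t : ℝ, 0 ≤ t → t ≤ 1 → |∑ i ∈ Finset.range D, c (i + 1) * t ^ (i + 1)| ≤ η) :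
    1 / (40 * Real.log M ^ 2) ≤ η := by
  have hLpos : 0 < Real.log M := by linarith
  have hMpos : 0 < M := by
    have h0D : 0 ∈ Finset.range D := Finset.mem_range.2 (by omega)
    have := Finset.single_le_sum (f := fun i => |c (i + 1)|) (fun i _ => abs_nonneg _) h0D
    simp only [zero_add, hc1, abs_one] at this
    linarith
  set u : ℝ := 1 / Real.log M with hu
  have hu0 : 0 < u := by rw [hu]; positivity
  have hu1 : u ≤ 1 / 2 := by
    rw [hu]; rw [div_le_div_iff₀ hLpos (by norm_num : (0:ℝ) < 2)]; linarith
  have hu2 : u < 2 := by linarith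
  have h := le_of_forall_abs_eval_le c hD hc1 hM hη hu0 hu2
  -- `M^{−u/(2−u)} = exp(−log M · u/(2−u)) = exp(−1/(2−u)) ≥ exp(−2/3) ≥ 1/3`
  have hpow : (1 : ℝ) / 3 ≤ M ^ (-(u / (2 - u))) := by
    rw [Real.rpow_def_of_pos hMpos]
    have h2u : 0 < 2 - u := by linarith
    have hexp : Real.log M * -(u / (2 - u)) = -(1 / (2 - u)) := by
      rw [hu]; field_simp
    rw [hexp]
    have h23 : -(1 / (2 - u)) ≥ -(2 / 3) := by
      rw [ge_iff_le, neg_le_neg_iff, div_le_div_iff₀ h2u (by norm_num : (0:ℝ) < 3)]; linarith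
    calc (1 : ℝ) / 3 ≤ -(2 / 3) + 1 := by norm_num
      _ ≤ Real.exp (-(2 / 3)) := Real.add_one_le_exp _
      _ ≤ Real.exp (-(1 / (2 - u))) := Real.exp_le_exp.2 h23
  -- `δ(u) ≥ u²/12.4`
  have hδ : u ^ 2 / (62 / 5) ≤ (Real.cosh u - 1) / (Real.cosh 2 + Real.cosh u) := by
    have hcu : Real.cosh u ≤ 2 := cosh_le_two hu0.le (by linarith)
    have hden : Real.cosh 2 + Real.cosh u ≤ 31 / 5 := by linarith [cosh_two_le]
    have hdenpos : 0 < Real.cosh 2 + Real.cosh u := by linarith [Real.cosh_pos 2, Real.cosh_pos u]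
    have hnum := sq_div_two_le_cosh_sub_one hu0.le
    rw [div_le_div_iff₀ (by norm_num : (0:ℝ) < 62 / 5) hdenpos]
    nlinarith [sq_nonneg u]
  -- combine
  have hfinal : 1 / (40 * Real.log M ^ 2) ≤ u ^ 2 / (62 / 5) * (1 / 3) := by
    have : u ^ 2 = 1 / Real.log M ^ 2 := by rw [hu]; field_simp
    rw [this]
    rw [div_mul_eq_mul_div, div_le_div_iff₀ (by positivity) (by norm_num : (0:ℝ) < 62 / 5)]
    have : 0 < Real.log M ^ 2 := by positivity
    field_simp
    nlinarith
  calc 1 / (40 * Real.log M ^ 2) ≤ u ^ 2 / (62 / 5) * (1 / 3) := hfinal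
    _ ≤ (Real.cosh u - 1) / (Real.cosh 2 + Real.cosh u) * M ^ (-(u / (2 - u))) := by
        gcongr
        · exact le_trans (by positivity) hδ
    _ ≤ η := h

/-- **The form used for correlation functions**: if, in addition, `|p(t)| ≤ p(1)` for all `t ∈ [0,1]` (e.g. `p ≥ 0` and non-decreasing on
`[0,1]`, `p(0) = 0`), then **`p(1) ≥ 1/(40·log²(max(e², M)))`** — no lower bound on `M` needed (the length bound `M` may be replaced by the
larger `max(e², M)`).  [cite: DeNadimpalliServedio2021, §4 Thm 15 (proof: `q(1) − q(0) ≥ sup_t |q(t) − q(0)|` for a monotone compatible pair)] -/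
theorem eval_one_ge_of_monotone (c : ℕ → ℝ) {D : ℕ} (hD : 1 ≤ D) (hc1 : c 1 = 1) {M : ℝ}
    (hM : ∑ i ∈ Finset.range D, |c (i + 1)| ≤ M)
    (hmono : ∀ t : ℝ, 0 ≤ t → t ≤ 1 →
      |∑ i ∈ Finset.range D, c (i + 1) * t ^ (i + 1)| ≤ ∑ i ∈ Finset.range D, c (i + 1)) :
    1 / (40 * Real.log (max (Real.exp 2) M) ^ 2) ≤ ∑ i ∈ Finset.range D, c (i + 1) := by
  have hM' : ∑ i ∈ Finset.range D, |c (i + 1)| ≤ max (Real.exp 2) M := hM.trans (le_max_right _ _)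
  have hlog : 2 ≤ Real.log (max (Real.exp 2) M) := by
    calc (2 : ℝ) = Real.log (Real.exp 2) := (Real.log_exp 2).symm
      _ ≤ Real.log (max (Real.exp 2) M) := Real.log_le_log (Real.exp_pos 2) (le_max_left _ _)
  have := le_of_forall_abs_eval_le_log c hD hc1 hM' hlog (η := ∑ i ∈ Finset.range D, c (i + 1)) hmono
  exact this

end Summit.CriticalPhenomena.PercolationContinuityZ3.Theorems.Crossing.Extremal

end
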